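import Literature.NumberTheory.Transcendental.KZRulesAssociator
import Summits.KontsevichZagierPeriods.KontsevichZagierPeriods.Theorems.MzvKernelInKZ.Negative.ScalingDivision
import Summits.KontsevichZagierPeriods.KontsevichZagierPeriods.Theorems.ValuedFieldSpecialisationCTConstructionDilateTyped

/-!
# Route ValuedFieldSpecialisation — crux `CTConstruction`: the log-power box and its cancellation

Helper toward crux stmt-KontsevichZagierPeriods-3495 (`CTConstruction`), line `registered`, stub
`stub_logPowCancellation_of_logTwo` of the lead's "dilation elimination". For `Q > 0` put
`μ = 2^{-Q}`; the **log-power box** is the representation `L_m = ([μ, 1]^m, ∏ t_j⁻¹)` (value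
`(Q log 2)^m`). We prove:

1. EXISTENCE of `L_m : KZ.IntegralRep m` with the stated domain and integrand, for every `m`
   (`exists_boxRep`: a continuous integrand on a compact `ℚ`-semialgebraic box);
2. SPLITTING: for box representations `L_m`, `L_{m'}`, `L_M` (`M = m + m'`) and every formal
   combination `c`, `[L_M] * c − [L_m] * ([L_{m'}] * c) ∈ KZ.relations` (`L_M = L_m.prod L_{m'}` on
   the nose, `boxRep_eq_prod`, and the Fubini product is associative modulo relations,
   `KZ.mul_assoc_sub_mem_relations`);
3. CANCELLATION: ASSUMING log2-cancellation (`[([1/2, 1], t⁻¹)] * c ∈ relations → c ∈ relations`,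
   an open kernel statement, taken as a hypothesis), `[L_m] * c ∈ relations → c ∈ relations`, by
   induction on `m` (`L_0 = [pt, 1]` is the unit; `L_{m+1} = L_m.prod L_1`), the one-dimensional
   case being `[L_1] ≡ Q • [L_half]` modulo relations (`of_box_sub_nsmul_half_mem_relations`:
   split `[2^{-Q}, 1]` into the dyadic pieces `[2^{-(i+1)}, 2^{-i}]` by domain additivity and map
   each onto `[1/2, 1]` by the change of variables `t ↦ 2^i t`) followed by integer division
   (`MzvKernelInKZ.Negative.mem_relations_of_nsmul_mem`).

Sources: M. Kontsevich, D. Zagier, *Periods* (2001), §1.2 (rules (1)–(2)), §4.1 (Fubini product);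
J. Bochnak, M. Coste, M.-F. Roy, *Real Algebraic Geometry* (1998), §2.2. No new definitions.
-/

noncomputable section

namespace Summit.KontsevichZagierPeriods.ValuedFieldSpecialisation

open MeasureTheory Set Filter MvPolynomial
open Literature.NumberTheory.Transcendental Literature.NumberTheory.Transcendental.KZ
open Literature.ModelTheory.ExponentialFields (IsSemialgebraic isSemialgebraic_setOf_eval_le)

/-! ## The box `[a, b]^m` and the log-power box representation -/

/-- The box `{t | a ≤ t j ≤ b}` of `ℝᵐ` with rational corners is `ℚ`-semialgebraic.
[Bochnak–Coste–Roy 1998, §2.1] [folklore] -/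
theorem isSemialgebraic_box (m : ℕ) (a b : ℚ) :
    IsSemialgebraic ℚ {t : Fin m → ℝ | ∀ j, ((a : ℚ) : ℝ) ≤ t j ∧ t j ≤ ((b : ℚ) : ℝ)} := by
  have h : ∀ j : Fin m,
      IsSemialgebraic ℚ {t : Fin m → ℝ | ((a : ℚ) : ℝ) ≤ t j ∧ t j ≤ ((b : ℚ) : ℝ)} := by
    intro j
    have ha : IsSemialgebraic ℚ {t : Fin m → ℝ | ((a : ℚ) : ℝ) ≤ t j} := by
      simpa using isSemialgebraic_setOf_eval_le (k := ℚ) (R := ℝ)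
        (C a : MvPolynomial (Fin m) ℚ) (X j)
    have hb : IsSemialgebraic ℚ {t : Fin m → ℝ | t j ≤ ((b : ℚ) : ℝ)} := by
      simpa using isSemialgebraic_setOf_eval_le (k := ℚ) (R := ℝ)
        (X j : MvPolynomial (Fin m) ℚ) (C b)
    simpa [setOf_and] using ha.inter hb
  convert IsSemialgebraic.biInter Finset.univ _ (fun j _ => h j) using 1
  ext t
  simp

/-- **EXISTENCE of the box representation** `([a, b]^m, ∏ t_j⁻¹)` for rationals `0 < a`, `b`: the
box is `ℚ`-semialgebraic and compact, the integrand `ℚ`-semialgebraic (a product of inverses of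
non-vanishing coordinates) and continuous on it, hence integrable.
[Kontsevich–Zagier 2001, §1.1] [folklore] -/
theorem exists_boxRep (m : ℕ) (a b : ℚ) (ha : 0 < a) :
    ∃ L : IntegralRep m, L.domain = {t | ∀ j, ((a : ℚ) : ℝ) ≤ t j ∧ t j ≤ ((b : ℚ) : ℝ)} ∧
      L.integrand = fun t => ∏ j, (t j)⁻¹ := by
  have hD := isSemialgebraic_box m a b
  have ha' : (0 : ℝ) < a := by exact_mod_cast ha
  have hne : ∀ t ∈ {t : Fin m → ℝ | ∀ j, ((a : ℚ) : ℝ) ≤ t j ∧ t j ≤ ((b : ℚ) : ℝ)}, ∀ j, t j ≠ 0 :=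
    fun t ht j => (ha'.trans_le (ht j).1).ne'
  refine ⟨⟨_, _, hD, ?_, ?_⟩, rfl, rfl⟩
  · exact isSemialgebraicFunOn_finset_prod' hD Finset.univ (fun j t => (t j)⁻¹) fun j _ =>
      (isSemialgebraicFunOn_apply hD j).inv fun t ht => hne t ht j
  · have hK : IsCompact {t : Fin m → ℝ | ∀ j, ((a : ℚ) : ℝ) ≤ t j ∧ t j ≤ ((b : ℚ) : ℝ)} := by
      convert isCompact_Icc (a := fun _ : Fin m => ((a : ℚ) : ℝ)) (b := fun _ => ((b : ℚ) : ℝ))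
        using 1
      ext t
      simp only [mem_setOf_eq, mem_Icc, Pi.le_def, forall_and]
    refine ContinuousOn.integrableOn_compact hK ?_
    exact continuousOn_finsetProd Finset.univ fun j _ =>
      (continuous_apply j).continuousOn.inv₀ fun t ht => hne t ht j

/-- The box representation with upper corner `1`. [Kontsevich–Zagier 2001, §1.1] [folklore] -/
theorem exists_boxRep_one (m : ℕ) (a : ℚ) (ha : 0 < a) :
    ∃ L : IntegralRep m, L.domain = {t | ∀ j, ((a : ℚ) : ℝ) ≤ t j ∧ t j ≤ 1} ∧
      L.integrand = fun t => ∏ j, (t j)⁻¹ := by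
  obtain ⟨L, hL, hLi⟩ := exists_boxRep m a 1 ha
  exact ⟨L, by rw [hL, Rat.cast_one], hLi⟩

/-- The representation `([1/2, 1], t⁻¹)` of `log 2`, in the coordinate form of the
log2-cancellation hypothesis. [Kontsevich–Zagier 2001, §1.1] [folklore] -/
theorem exists_halfRep :
    ∃ L : IntegralRep 1, L.domain = {t | (1 / 2 : ℝ) ≤ t 0 ∧ t 0 ≤ 1} ∧
      L.integrand = fun t => (t 0)⁻¹ := by
  obtain ⟨L, hL, hLi⟩ := exists_boxRep 1 (1 / 2) 1 (by norm_num)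
  refine ⟨L, ?_, ?_⟩
  · rw [hL]
    ext t
    simp only [mem_setOf_eq, Fin.forall_fin_one, Fin.isValue, Rat.cast_one, Rat.cast_div,
      Rat.cast_ofNat]
  · rw [hLi]
    funext t
    exact Fin.prod_univ_one _

/-! ## Splitting: `L_{m+m'} = L_m × L_{m'}` and associativity modulo relations -/

/-- **The box representation in dimension `m + m'` IS the product of the box representations in
dimensions `m` and `m'`** (same domain by `Fin.forall_fin_add`, same integrand by
`Fin.prod_univ_add` and `KZ.IntegralRep.prod_integrand_eq`). [Kontsevich–Zagier 2001, §4.1]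
[folklore] -/
theorem boxRep_eq_prod {m m' : ℕ} {μ : ℝ} (Lm : IntegralRep m) (Lm' : IntegralRep m')
    (L : IntegralRep (m + m'))
    (hm : Lm.domain = {t | ∀ j, μ ≤ t j ∧ t j ≤ 1}) (hmi : Lm.integrand = fun t => ∏ j, (t j)⁻¹)
    (hm' : Lm'.domain = {t | ∀ j, μ ≤ t j ∧ t j ≤ 1}) (hmi' : Lm'.integrand = fun t => ∏ j, (t j)⁻¹)
    (hL : L.domain = {t | ∀ j, μ ≤ t j ∧ t j ≤ 1}) (hLi : L.integrand = fun t => ∏ j, (t j)⁻¹) :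
    L = Lm.prod Lm' := by
  refine IntegralRep.ext' ?_ ?_
  · rw [hL, IntegralRep.prod_domain]
    ext z
    simp only [mem_setOf_eq, IntegralRep.mem_prodDomain, hm, hm']
    exact Fin.forall_fin_add _
  · rw [hLi, IntegralRep.prod_integrand_eq]
    funext z
    simp only [IntegralRep.prodFun_apply, hmi, hmi']
    exact Fin.prod_univ_add _

/-- **SPLITTING**: for box representations `L_m`, `L_{m'}`, `L_M` with `M = m + m'` and every formal
combination `c`, `[L_M] * c − [L_m] * ([L_{m'}] * c) ∈ relations`: `[L_M] = [L_m] * [L_{m'}]` on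
the nose (`boxRep_eq_prod`, `KZ.of_mul_of`) and the Fubini product is associative modulo relations
(`KZ.mul_assoc_sub_mem_relations`). [Kontsevich–Zagier 2001, §4.1] [folklore] -/
theorem boxRep_split {μ : ℝ} (m m' M : ℕ) (Lm : IntegralRep m) (Lm' : IntegralRep m')
    (Lmm' : IntegralRep M) (hM : M = m + m')
    (hm : Lm.domain = {t | ∀ j, μ ≤ t j ∧ t j ≤ 1}) (hmi : Lm.integrand = fun t => ∏ j, (t j)⁻¹)
    (hm' : Lm'.domain = {t | ∀ j, μ ≤ t j ∧ t j ≤ 1}) (hmi' : Lm'.integrand = fun t => ∏ j, (t j)⁻¹)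
    (hL : Lmm'.domain = {t | ∀ j, μ ≤ t j ∧ t j ≤ 1})
    (hLi : Lmm'.integrand = fun t => ∏ j, (t j)⁻¹) (c : FormalRep) :
    of Lmm' * c - of Lm * (of Lm' * c) ∈ relations := by
  subst hM
  rw [boxRep_eq_prod Lm Lm' Lmm' hm hmi hm' hmi' hL hLi, ← of_mul_of]
  exact mul_assoc_sub_mem_relations _ _ _

/-! ## Cancellation in dimension one: `[([2^{-Q}, 1], t⁻¹)] ≡ Q • [([1/2, 1], t⁻¹)]` -/

/-- **Splitting an interval box**: for rationals `a' ≤ a ≤ 1`, the representation on `[a', 1]`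
minus those on `[a, 1]` and on `[a', a]` (all with integrand `∏ t_j⁻¹`, dimension `1`) is an
instance of domain additivity (the overlap `{a}` is null). [Kontsevich–Zagier 2001, §1.2 rule (1)]
[folklore] -/
theorem of_box_sub_of_box_sub_of_box_mem_relations {a a' : ℚ} (ha : a' ≤ a) (ha1 : a ≤ 1)
    (A' A P : IntegralRep 1)
    (hA' : A'.domain = {t | ∀ j, ((a' : ℚ) : ℝ) ≤ t j ∧ t j ≤ 1})
    (hA'i : A'.integrand = fun t => ∏ j, (t j)⁻¹)
    (hA : A.domain = {t | ∀ j, ((a : ℚ) : ℝ) ≤ t j ∧ t j ≤ 1})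
    (hAi : A.integrand = fun t => ∏ j, (t j)⁻¹)
    (hP : P.domain = {t | ∀ j, ((a' : ℚ) : ℝ) ≤ t j ∧ t j ≤ ((a : ℚ) : ℝ)})
    (hPi : P.integrand = fun t => ∏ j, (t j)⁻¹) :
    of A' - of A - of P ∈ relations := by
  have har : ((a' : ℚ) : ℝ) ≤ a := by exact_mod_cast ha
  have ha1r : ((a : ℚ) : ℝ) ≤ 1 := by exact_mod_cast ha1
  refine domainAddRel_subset_relations ⟨1, A', A, P, ?_, ?_, ?_, ?_, rfl⟩
  · rw [hA', hA, hP]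
    ext t
    simp only [mem_setOf_eq, mem_union, Fin.forall_fin_one, Fin.isValue]
    constructor
    · rintro ⟨h1, h2⟩
      rcases le_total ((a : ℚ) : ℝ) (t 0) with h | h
      · exact Or.inl ⟨h, h2⟩
      · exact Or.inr ⟨h1, h⟩
    · rintro (⟨h1, h2⟩ | ⟨h1, h2⟩)
      · exact ⟨har.trans h1, h2⟩
      · exact ⟨h1, h2.trans ha1r⟩
  · have hsub :
        A.domain ∩ P.domain ⊆ Icc (fun _ : Fin 1 => ((a : ℚ) : ℝ)) (fun _ => ((a : ℚ) : ℝ)) := by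
      rw [hA, hP]
      intro t ht
      exact ⟨fun j => (ht.1 j).1, fun j => (ht.2 j).2⟩
    refine measure_mono_null hsub ?_
    rw [Real.volume_Icc_pi]
    simp
  · rw [hA'i, hAi]
    exact fun _ _ => rfl
  · rw [hA'i, hPi]
    exact fun _ _ => rfl

/-- **The dyadic piece `[2^{-(i+1)}, 2^{-i}]` is `[1/2, 1]` up to the change of variables
`t ↦ 2^i t`** (linear, `|det| = 2^i`, `t⁻¹ = (2^i t)⁻¹ · 2^i`): `[P_i] − [L_half] ∈ relations`.
[Kontsevich–Zagier 2001, §1.2 rule (2)] [folklore] -/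
theorem of_piece_sub_of_half_mem_relations (i : ℕ) (P Lh : IntegralRep 1)
    (hP : P.domain = {t | ∀ j, ((((1 / 2 : ℚ)) ^ (i + 1) : ℚ) : ℝ) ≤ t j ∧
      t j ≤ ((((1 / 2 : ℚ)) ^ i : ℚ) : ℝ)})
    (hPi : P.integrand = fun t => ∏ j, (t j)⁻¹)
    (hLh : Lh.domain = {t | (1 / 2 : ℝ) ≤ t 0 ∧ t 0 ≤ 1}) (hLhi : Lh.integrand = fun t => (t 0)⁻¹) :
    of P - of Lh ∈ relations := by
  have hc : (0 : ℝ) < 2 ^ i := by positivity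
  obtain ⟨L, hL, hLs, hdet⟩ := exists_scaleEquiv 1 0 hc.ne'
  have e1 : (2 : ℝ) ^ i * ((((1 / 2 : ℚ)) ^ (i + 1) : ℚ) : ℝ) = 1 / 2 := by
    rw [Rat.cast_pow, pow_succ, ← mul_assoc, ← mul_pow]
    norm_num
  have e2 : (2 : ℝ) ^ i * ((((1 / 2 : ℚ)) ^ i : ℚ) : ℝ) = 1 := by
    rw [Rat.cast_pow, ← mul_pow]
    norm_num
  refine changeOfVariablesRel_subset_relations
    ⟨1, P, Lh, ⇑L, fun _ => (L : (Fin 1 → ℝ) →L[ℝ] (Fin 1 → ℝ)), ?_, ?_, ?_, ?_, ?_, rfl⟩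
  · refine (isSemialgebraicMapOn_scale P.isSemialgebraic_domain 0 ((2 : ℚ) ^ i)).congr
      fun z _ => ?_
    rw [hL]
    simp
  · exact fun x _ => L.hasFDerivWithinAt
  · exact L.injective.injOn
  · rw [ContinuousLinearEquiv.image_eq_preimage_symm, hLh, hP]
    ext t
    simp only [mem_setOf_eq, mem_preimage, hLs, Fin.forall_fin_one, Fin.isValue,
      Function.update_self]
    rw [le_inv_mul_iff₀ hc, inv_mul_le_iff₀ hc, e1, e2]
  · intro x hx
    simp only [hPi, hLhi, hL, hdet, Fin.prod_univ_one, Fin.isValue, Function.update_self,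
      abs_of_pos hc]
    rw [mul_inv_rev, inv_mul_cancel_right₀ hc.ne']

/-- **`[([2^{-i}, 1], t⁻¹)] ≡ i • [([1/2, 1], t⁻¹)]` modulo relations**, by induction on `i`: the
box `[1, 1]` is null, and `[2^{-(i+1)}, 1] = [2^{-i}, 1] ∪ [2^{-(i+1)}, 2^{-i}]`
(`of_box_sub_of_box_sub_of_box_mem_relations`) with the new piece equivalent to `[1/2, 1]`
(`of_piece_sub_of_half_mem_relations`). [Kontsevich–Zagier 2001, §1.2 rules (1)–(2)] [folklore] -/
theorem of_box_sub_nsmul_half_mem_relations (Lh : IntegralRep 1)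
    (hLh : Lh.domain = {t | (1 / 2 : ℝ) ≤ t 0 ∧ t 0 ≤ 1}) (hLhi : Lh.integrand = fun t => (t 0)⁻¹) :
    ∀ (i : ℕ) (A : IntegralRep 1),
      A.domain = {t | ∀ j, ((((1 / 2 : ℚ)) ^ i : ℚ) : ℝ) ≤ t j ∧ t j ≤ 1} →
      A.integrand = (fun t => ∏ j, (t j)⁻¹) → of A - i • of Lh ∈ relations := by
  intro i
  induction i with
  | zero =>
    intro A hA _
    rw [zero_smul, sub_zero]
    have hsub : A.domain ⊆ Icc (fun _ : Fin 1 => (1 : ℝ)) (fun _ => 1) := by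
      rw [hA]
      intro t ht
      simp only [pow_zero, Rat.cast_one, mem_setOf_eq] at ht
      exact ⟨fun j => (ht j).1, fun j => (ht j).2⟩
    have hvol : volume A.domain = 0 := by
      refine measure_mono_null hsub ?_
      rw [Real.volume_Icc_pi]
      simp
    -- a representation over a null domain is a relation: `[A] - [A] - [A] ∈ domainAddRel`
    have h0 : of A - of A - of A ∈ relations :=
      domainAddRel_subset_relations ⟨1, A, A, A, (union_self _).symm, by rwa [inter_self],
        fun _ _ => rfl, fun _ _ => rfl, rfl⟩
    have : of A = -(of A - of A - of A) := by abel
    rw [this]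
    exact relations.neg_mem h0
  | succ i ih =>
    intro A' hA' hA'i
    have h2pos : (0 : ℚ) < 1 / 2 := by norm_num
    obtain ⟨A, hA, hAi⟩ := exists_boxRep_one 1 ((1 / 2 : ℚ) ^ i) (by positivity)
    obtain ⟨P, hP, hPi⟩ := exists_boxRep 1 ((1 / 2 : ℚ) ^ (i + 1)) ((1 / 2 : ℚ) ^ i) (by positivity)
    have h1 : of A' - of A - of P ∈ relations :=
      of_box_sub_of_box_sub_of_box_mem_relations
        (pow_le_pow_of_le_one h2pos.le (by norm_num) (Nat.le_succ i))
        (pow_le_one₀ h2pos.le (by norm_num)) A' A P hA' hA'i hA hAi hP hPi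
    have h2 : of P - of Lh ∈ relations := of_piece_sub_of_half_mem_relations i P Lh hP hPi hLh hLhi
    have h3 : of A - i • of Lh ∈ relations := ih A hA hAi
    have : of A' - (i + 1) • of Lh =
        (of A' - of A - of P) + (of P - of Lh) + (of A - i • of Lh) := by
      rw [succ_nsmul]
      abel
    rw [this]
    exact relations.add_mem (relations.add_mem h1 h2) h3

/-- **CANCELLATION of the log-power box, from log2-cancellation.** If `[([1/2, 1], t⁻¹)] * c ∈
relations` forces `c ∈ relations` (hypothesis), then so does `[L_m] * c ∈ relations` for the box
`L_m = ([2^{-Q}, 1]^m, ∏ t_j⁻¹)`, `Q > 0`: induction on `m` through `L_0 = [pt, 1]`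
(`KZ.of_unit_mul_sub_mem_relations`), `[L_{m+1}] * c ≡ [L_m] * ([L_1] * c)` (`boxRep_split`),
`[L_1] ≡ Q • [L_half]` (`of_box_sub_nsmul_half_mem_relations`), the right ideal property
(`KZ.mul_mem_relations_right_holds`) and integer division
(`MzvKernelInKZ.Negative.mem_relations_of_nsmul_mem`). [Kontsevich–Zagier 2001, §1.2, §4.1]
[folklore] -/
theorem boxRep_cancel (Q : ℕ) (hQ : 0 < Q)
    (H : ∀ (L : IntegralRep 1), L.domain = {t | (1 / 2 : ℝ) ≤ t 0 ∧ t 0 ≤ 1} →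
      L.integrand = (fun t => (t 0)⁻¹) → ∀ c : FormalRep, of L * c ∈ relations → c ∈ relations) :
    ∀ (m : ℕ) (Lm : IntegralRep m),
      Lm.domain = {t | ∀ j, ((((1 / 2 : ℚ)) ^ Q : ℚ) : ℝ) ≤ t j ∧ t j ≤ 1} →
      Lm.integrand = (fun t => ∏ j, (t j)⁻¹) →
      ∀ c : FormalRep, of Lm * c ∈ relations → c ∈ relations := by
  have hμ : (0 : ℚ) < (1 / 2) ^ Q := by positivity
  obtain ⟨Lh, hLh, hLhi⟩ := exists_halfRep
  -- dimension one
  have h1 : ∀ (L1 : IntegralRep 1),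
      L1.domain = {t | ∀ j, ((((1 / 2 : ℚ)) ^ Q : ℚ) : ℝ) ≤ t j ∧ t j ≤ 1} →
      L1.integrand = (fun t => ∏ j, (t j)⁻¹) →
      ∀ c : FormalRep, of L1 * c ∈ relations → c ∈ relations := by
    intro L1 hL1 hL1i c hc
    have hrel : of L1 - Q • of Lh ∈ relations :=
      of_box_sub_nsmul_half_mem_relations Lh hLh hLhi Q L1 hL1 hL1i
    have h2 : (of L1 - Q • of Lh) * c ∈ relations := mul_mem_relations_right_holds _ c hrel
    rw [sub_mul, smul_mul_assoc] at h2
    have h3 : Q • (of Lh * c) ∈ relations := by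
      have := relations.sub_mem hc h2
      rwa [sub_sub_cancel] at this
    exact H Lh hLh hLhi c
      (Summit.KontsevichZagierPeriods.MzvKernelInKZ.Negative.mem_relations_of_nsmul_mem hQ h3)
  intro m
  induction m with
  | zero =>
    intro L0 hL0 hL0i c hc
    have hu : L0 = IntegralRep.unit := by
      refine IntegralRep.ext' ?_ ?_
      · rw [hL0, IntegralRep.unit_domain]
        exact Set.eq_univ_of_forall fun t j => j.elim0
      · rw [hL0i, IntegralRep.unit_integrand]
        funext t
        exact Fin.prod_univ_zero _
    rw [hu] at hc
    have := relations.sub_mem hc (of_unit_mul_sub_mem_relations c)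
    rwa [sub_sub_cancel] at this
  | succ m ih =>
    intro L hL hLi c hc
    obtain ⟨Lm, hLm, hLmi⟩ := exists_boxRep_one m ((1 / 2 : ℚ) ^ Q) hμ
    obtain ⟨L1, hL1, hL1i⟩ := exists_boxRep_one 1 ((1 / 2 : ℚ) ^ Q) hμ
    have hsplit : of L * c - of Lm * (of L1 * c) ∈ relations :=
      boxRep_split m 1 (m + 1) Lm L1 L rfl hLm hLmi hL1 hL1i hL hLi c
    have h4 : of Lm * (of L1 * c) ∈ relations := by
      have := relations.sub_mem hc hsplit
      rwa [sub_sub_cancel] at this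
    exact h1 L1 hL1 hL1i c (ih Lm hLm hLmi _ h4)

/-! ## The stub -/

/-- **Stub `stub_logPowCancellation_of_logTwo`** (the log-power box algebra of the pure-log phase of
dilation elimination). For `Q > 0` and `μ = 2^{-Q}`: (1) the box representation
`L_m = ([μ, 1]^m, ∏ t_j⁻¹)` exists in every dimension `m` (`exists_boxRep_one`); (2) for box
representations `L_m`, `L_{m'}`, `L_M` (`M = m + m'`), `[L_M] * c − [L_m] * ([L_{m'}] * c) ∈
KZ.relations` for every formal combination `c` (`boxRep_split`); (3) assuming log2-cancellation for
`([1/2, 1], t⁻¹)`, `[L_m] * c ∈ relations → c ∈ relations` (`boxRep_cancel`).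
[Kontsevich–Zagier 2001, §1.2, §4.1] [folklore] -/
theorem stub_logPowCancellation_of_logTwo : ∀ (Q : ℕ), 0 < Q → (∀ m : ℕ, ∃ Lm : Literature.NumberTheory.Transcendental.KZ.IntegralRep m, Lm.domain = {t | ∀ j, (((1 / 2 : ℚ) ^ Q : ℚ) : ℝ) ≤ t j ∧ t j ≤ 1} ∧ Lm.integrand = (fun t => ∏ j, (t j)⁻¹)) ∧ (∀ (m m' M : ℕ) (Lm : Literature.NumberTheory.Transcendental.KZ.IntegralRep m) (Lm' : Literature.NumberTheory.Transcendental.KZ.IntegralRep m') (Lmm' : Literature.NumberTheory.Transcendental.KZ.IntegralRep M), M = m + m' → Lm.domain = {t | ∀ j, (((1 / 2 : ℚ) ^ Q : ℚ) : ℝ) ≤ t j ∧ t j ≤ 1} → Lm.integrand = (fun t => ∏ j, (t j)⁻¹) → Lm'.domain = {t | ∀ j, (((1 / 2 : ℚ) ^ Q : ℚ) : ℝ) ≤ t j ∧ t j ≤ 1} → Lm'.integrand = (fun t => ∏ j, (t j)⁻¹) → Lmm'.domain = {t | ∀ j, (((1 / 2 : ℚ) ^ Q : ℚ) : ℝ)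 ≤ t j ∧ t j ≤ 1} → Lmm'.integrand = (fun t => ∏ j, (t j)⁻¹) → ∀ c : Literature.NumberTheory.Transcendental.KZ.FormalRep, Literature.NumberTheory.Transcendental.KZ.of Lmm' * c - Literature.NumberTheory.Transcendental.KZ.of Lm * (Literature.NumberTheory.Transcendental.KZ.of Lm' * c) ∈ Literature.NumberTheory.Transcendental.KZ.relations) ∧ ((∀ (L : Literature.NumberTheory.Transcendental.KZ.IntegralRep 1), L.domain = {t | (1 / 2 : ℝ) ≤ t 0 ∧ t 0 ≤ 1} → L.integrand = (fun t => (t 0)⁻¹) → ∀ c : Literature.NumberTheory.Transcendental.KZ.FormalRep, Literature.NumberTheory.Transcendental.KZ.of L * c ∈ Literature.NumberTheory.Transcendental.KZ.relations → c ∈ Literature.NumberTheory.Transcendental.KZ.relations) → ∀ (m : ℕ) (Lm : Literature.NumberTheory.Transcendental.KZ.IntegralRep m), Lm.domain = {t | ∀ j, (((1 / 2 : ℚ) ^ Q : ℚ) : ℝ) ≤ t j ∧ t j ≤ 1} → Lm.integrand = (fun t => ∏ j, (t j)⁻¹) → ∀ c : Literature.NumberTheory.Transcendental.KZ.FormalRep,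 Literature.NumberTheory.Transcendental.KZ.of Lm * c ∈ Literature.NumberTheory.Transcendental.KZ.relations → c ∈ Literature.NumberTheory.Transcendental.KZ.relations) := by
  intro Q hQ
  refine ⟨fun m => exists_boxRep_one m ((1 / 2 : ℚ) ^ Q) (by positivity), ?_, boxRep_cancel Q hQ⟩
  intro m m' M Lm Lm' Lmm' hM hLm hLmi hLm' hLm'i hL hLi c
  exact boxRep_split m m' M Lm Lm' Lmm' hM hLm hLmi hLm' hLm'i hL hLi c

end Summit.KontsevichZagierPeriods.ValuedFieldSpecialisation
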